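import Summits.AtomisticToContinuum.BoseEinsteinCondensation.Theorems.BECGroundStateSOSPeriodicIRBoundTwoSectorDefs
import Summits.AtomisticToContinuum.BoseEinsteinCondensation.Theorems.BECGroundStateSOSPeriodicIRBoundWFAssembly
import Summits.AtomisticToContinuum.BoseEinsteinCondensation.Theorems.BECGroundStateSOSPeriodicIRBoundWFRegularity
import Summits.AtomisticToContinuum.BoseEinsteinCondensation.Theorems.BECGroundStateSOSPeriodicIRBoundWFHeartKin
import HarnessLib

/-!
# Route `BECGroundStateSOS`, crux `PeriodicIRBound` (stmt-AtomisticToContinuum-3972), line `two-sector-gd-transfer` —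
# stub S4 `stub_klsNearMinimiser : KLSNearMinimiser` (the Kennedy–Lieb–Shastry Cauchy–Schwarz at a near-minimiser)

Supports (does not close) stmt-AtomisticToContinuum-3972. The registered stub S4 of the skeleton
`Cruxes/PeriodicIRBound/Lines/two_sector_gd_transfer.lean` (statement `KLSNearMinimiser` = `∀ v` integrable admissible,
`KLSMomentFor v`, in `Theorems/BECGroundStateSOSPeriodicIRBoundTwoSectorDefs.lean`): at fixed `(N, L) = (m+2, L)` with finite
`E₀(N−1), E₀(N), E₀(N+1)`, a mode `n ≠ 0` and `b ≥ 0`, the two REGULARISED channel susceptibility bounds `SuscPlus v N L n b`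
(pair `(N, N+1)`) and `SuscMinus v (N−1) L n b` (pair `(N−1, N)`) give, for every `η > 0`, a slack `δ > 0` such that every
`δ`-near-minimiser `Ψ` of `H_N` obeys, with `n_k = n_Ψ(φ_n)` and `y = 2n_k + 1`,
`y² ≤ 2b·[(1+η)·(|2πn/L|² + 2N‖v‖₁/L³ + E₀(N)·y − E₀(N−1)·n_k − E₀(N+1)·(n_k+1)) + η·(y+1)]`.

Proof (first quantisation, every analytic input a landed lemma of the `WF` toolkit of line `linear-ph-floor-wagner`): with
`a = a(φ_n)`, `a† = a†(φ_n)` (`TorusFockLayer.modeAn/modeCr`) and `ψ = Ψ.ψ`,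
* `‖aψ‖² = n_k` (`WF.normSq_modeAn`) and `‖a†ψ‖² = 1 + n_k` (`WF.normSq_modeCr`);
* channel `+` at the normalised state `a†ψ/‖a†ψ‖` (`WF.IsCore.toTrialState`, energy `𝓔[a†ψ]/‖a†ψ‖²`; transfer matrix element
  `Re⟨ψ, a a†ψ⟩/‖a†ψ‖ = ‖a†ψ‖` by adjointness `integral_conj_modeCr_mul`): `‖a†ψ‖⁴ ≤ b((1+η)(𝓔[a†ψ] − E₀(N+1)‖a†ψ‖²) + η‖a†ψ‖²)`;
* channel `−` at `aψ/‖aψ‖` (matrix element `Re⟨aψ, aψ⟩/‖aψ‖ = ‖aψ‖`): `‖aψ‖⁴ ≤ b((1+η)(𝓔[aψ] − E₀(N−1)‖aψ‖²) + η‖aψ‖²)`;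
* `y²/2 ≤ ‖aψ‖⁴ + ‖a†ψ‖⁴` and the Wagner–Feynman form inequality `𝓔[aψ] + 𝓔[a†ψ] ≤ (|2πn/L|² + 2N‖v‖₁/L³)‖ψ‖² + 𝓔[ψ] + 2Re B(ψ, a†aψ)`
  (`WF.wagnerFeynman_form_le`) with `𝓔[ψ] ≤ E₀(N) + δ` and the near-minimiser cross-term bound
  `|Re B(ψ, a†aψ) − E₀(N)·n_k| ≤ √δ·√𝓔[a†aψ]` (`WF.abs_formRe_sub_le`, `WF.innerRe_numOp`), `𝓔[a†aψ] ≤ K_b(N, L, n, ‖v‖₁, E₀+1)`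
  a priori (`WF.qform_modeAn_le`, `WF.qform_modeCr_le`);
* the slack `δ = min(δ₊(η), δ₋(η), δ₀)` with `(1+η)(δ₀ + 2√δ₀√K_b) ≤ η` absorbs the error into `η(y+1)` (`KLS.real_core`).
No open mathematics. References (shape only; nothing is cited as a fact): T. Kennedy, E. H. Lieb, B. S. Shastry, J. Stat. Phys. 53
(1988) 1019, (12)–(14); H. Wagner, Z. Physik 195 (1966) 273, §2; LSSY2005 App. A.
-/

noncomputable section

open scoped BigOperators ENNReal ComplexConjugate
open Filter MeasureTheory

namespace Summit.AtomisticToContinuum.BoseEinsteinCondensation.Cruxes.PeriodicIRBound.TwoSectorGdTransfer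

open Literature.MathematicalPhysics.QuantumManyBody.BoseGas
open Summit.AtomisticToContinuum.BoseEinsteinCondensation.Cruxes.PeriodicIRBound.LinearPhFloorWagner.WF

namespace KLS

/-! ### The real-arithmetic core and the choice of the slack -/

/-- **Real-arithmetic core of the KLS step at a near-minimiser.** From the two channel bounds (`hP` at `a†ψ`, `hM` at `aψ`,
`nC = nA + 1`), the Wagner–Feynman form inequality `hWF`, near-minimality `hq`, the cross-term control `hB` with the a priori
bound `K ≤ Kb` and the slack condition `(1+η)(δ + 2√δ√Kb) ≤ η`, deduce the moment inequality for `y = 2nA + 1`. [folklore] -/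
theorem real_core {nA nC qA qC q e0 e1 e3 b η D δ B K Kb : ℝ}
    (hb : 0 ≤ b) (hη : 0 < η) (hnC : nC = nA + 1)
    (hP : nC ^ 2 ≤ b * ((1 + η) * (qC - e3 * nC) + η * nC))
    (hM : nA ^ 2 ≤ b * ((1 + η) * (qA - e1 * nA) + η * nA))
    (hWF : qA + qC ≤ D + q + 2 * B)
    (hq : q ≤ e0 + δ)
    (hB : |B - e0 * nA| ≤ Real.sqrt δ * Real.sqrt K)
    (hK : K ≤ Kb)
    (hslack : (1 + η) * (δ + 2 * (Real.sqrt δ * Real.sqrt Kb)) ≤ η) :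
    (2 * nA + 1) ^ 2 ≤
      2 * b * ((1 + η) * (D + e0 * (2 * nA + 1) - e1 * nA - e3 * (nA + 1)) + η * (2 * nA + 2)) := by
  subst hnC
  -- the cross term
  have hsK : Real.sqrt K ≤ Real.sqrt Kb := Real.sqrt_le_sqrt hK
  have hsδ : 0 ≤ Real.sqrt δ := Real.sqrt_nonneg δ
  have hB' : B ≤ e0 * nA + Real.sqrt δ * Real.sqrt Kb := by
    have h1 : B - e0 * nA ≤ Real.sqrt δ * Real.sqrt K := (abs_le.mp hB).2
    have h2 : Real.sqrt δ * Real.sqrt K ≤ Real.sqrt δ * Real.sqrt Kb := mul_le_mul_of_nonneg_left hsK hsδ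
    linarith
  -- the excess energies of the two channels, summed
  set D₀ : ℝ := D + e0 * (2 * nA + 1) - e1 * nA - e3 * (nA + 1) with hD₀
  have hsum : qA - e1 * nA + (qC - e3 * (nA + 1)) ≤ D₀ + (δ + 2 * (Real.sqrt δ * Real.sqrt Kb)) := by
    rw [hD₀]; linarith
  have h1η : 0 ≤ 1 + η := by linarith
  have hin : (1 + η) * (qA - e1 * nA + (qC - e3 * (nA + 1))) + η * (nA + (nA + 1)) ≤
      (1 + η) * D₀ + η * (2 * nA + 2) := by
    have h1 : (1 + η) * (qA - e1 * nA + (qC - e3 * (nA + 1))) ≤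
        (1 + η) * (D₀ + (δ + 2 * (Real.sqrt δ * Real.sqrt Kb))) := mul_le_mul_of_nonneg_left hsum h1η
    have h2 : (1 + η) * (D₀ + (δ + 2 * (Real.sqrt δ * Real.sqrt Kb))) =
        (1 + η) * D₀ + (1 + η) * (δ + 2 * (Real.sqrt δ * Real.sqrt Kb)) := by ring
    have h3 : η * (nA + (nA + 1)) ≤ η * (2 * nA + 2) := by nlinarith
    linarith
  -- add the two channel bounds
  have hadd : nA ^ 2 + (nA + 1) ^ 2 ≤
      b * ((1 + η) * (qA - e1 * nA + (qC - e3 * (nA + 1))) + η * (nA + (nA + 1))) := by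
    have : b * ((1 + η) * (qA - e1 * nA) + η * nA) + b * ((1 + η) * (qC - e3 * (nA + 1)) + η * (nA + 1)) =
        b * ((1 + η) * (qA - e1 * nA + (qC - e3 * (nA + 1))) + η * (nA + (nA + 1))) := by ring
    linarith
  have hmono : b * ((1 + η) * (qA - e1 * nA + (qC - e3 * (nA + 1))) + η * (nA + (nA + 1))) ≤
      b * ((1 + η) * D₀ + η * (2 * nA + 2)) := mul_le_mul_of_nonneg_left hin hb
  have hsq : (2 * nA + 1) ^ 2 ≤ 2 * (nA ^ 2 + (nA + 1) ^ 2) := by nlinarith [sq_nonneg (nA - (nA + 1))]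
  have hfin : 2 * (nA ^ 2 + (nA + 1) ^ 2) ≤ 2 * (b * ((1 + η) * D₀ + η * (2 * nA + 2))) := by linarith
  calc (2 * nA + 1) ^ 2 ≤ 2 * (b * ((1 + η) * D₀ + η * (2 * nA + 2))) := hsq.trans hfin
    _ = 2 * b * ((1 + η) * (D + e0 * (2 * nA + 1) - e1 * nA - e3 * (nA + 1)) + η * (2 * nA + 2)) := by
        rw [hD₀]; ring

/-- **Choice of the slack**: for `η > 0` and `Kb ≥ 0` there is `δ₀ ∈ (0, 1]` with `(1+η)(δ + 2√δ√Kb) ≤ η` for all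
`0 ≤ δ ≤ δ₀` (continuity at `δ = 0`, where the left side vanishes). [folklore] -/
theorem exists_slack {η Kb : ℝ} (hη : 0 < η) :
    ∃ δ₀ : ℝ, 0 < δ₀ ∧ δ₀ ≤ 1 ∧ ∀ δ : ℝ, 0 ≤ δ → δ ≤ δ₀ →
      (1 + η) * (δ + 2 * (Real.sqrt δ * Real.sqrt Kb)) ≤ η := by
  set F : ℝ → ℝ := fun δ => (1 + η) * (δ + 2 * (Real.sqrt δ * Real.sqrt Kb)) with hF
  have hcont : Continuous F := by
    rw [hF]
    fun_prop
  have hF0 : F 0 = 0 := by simp [hF]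
  have hlt : F 0 < η := by rw [hF0]; exact hη
  have hev : ∀ᶠ δ in nhds (0 : ℝ), F δ < η := (hcont.tendsto 0).eventually_lt_const hlt
  obtain ⟨r, hr, hrF⟩ := Metric.eventually_nhds_iff.mp hev
  refine ⟨min (r / 2) 1, lt_min (by positivity) one_pos, min_le_right _ _, fun δ hδ hδr => le_of_lt ?_⟩
  have hdist : dist δ 0 < r := by
    rw [Real.dist_eq, sub_zero, abs_of_nonneg hδ]
    exact lt_of_le_of_lt (hδr.trans (min_le_left _ _)) (by linarith)
  exact hrF hdist

/-! ### Small conversions -/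

/-- `toReal` of a coefficient `(m + 1 : ℝ≥0∞)`. -/
private theorem toReal_natCast_add_one (m : ℕ) : ((m : ℝ≥0∞) + 1).toReal = (m : ℝ) + 1 := by
  rw [ENNReal.toReal_add (ENNReal.natCast_ne_top m) ENNReal.one_ne_top, ENNReal.toReal_natCast,
    ENNReal.toReal_one]

/-- `(m + 1 : ℝ≥0∞) ≠ ⊤`. -/
private theorem natCast_add_one_ne_top (m : ℕ) : ((m : ℝ≥0∞) + 1) ≠ ⊤ :=
  ENNReal.add_ne_top.2 ⟨ENNReal.natCast_ne_top m, ENNReal.one_ne_top⟩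

/-- `a(φ)` of a constant multiple: `a(φ)(c·f) = c·a(φ)f` pointwise. [folklore] -/
theorem modeAn_const_mul (L : ℝ) (φ : Space → ℂ) {k : ℕ} (c : ℂ) (f : Config (k + 1) → ℂ) :
    modeAn L φ (fun X => c * f X) = fun Y => c * modeAn L φ f Y :=
  modeAn_smul L φ c f

/-- `Re (r⁻¹ · r') ` bookkeeping: `(√x)⁻¹ · x = √x` for `x ≥ 0`, as the real part of a complex product. [folklore] -/
theorem re_inv_sqrt_mul_self {x : ℝ} (hx : 0 ≤ x) :
    (((Real.sqrt x)⁻¹ : ℂ) * ((x : ℝ) : ℂ)).re = Real.sqrt x := by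
  have _ := hx
  rw [← Complex.ofReal_inv, ← Complex.ofReal_mul, Complex.ofReal_re, inv_mul_eq_div, Real.div_sqrt]

/-! ### The KLS moment inequality at a near-minimiser -/

variable {m : ℕ} {L : ℝ}

/-- **The per-potential KLS moment inequality** `KLSMomentFor v` for an integrable admissible `v` (stub S4, names inlined):
see the module docstring for the chain. -/
theorem klsMomentFor (v : ℝ → ℝ≥0∞) (hv : IsRepulsiveFiniteRange v) (hint : (∫⁻ x : Space, v ‖x‖) ≠ ⊤) :
    KLSMomentFor v := by
  intro m L hL _hE1 hE2 _hE3 n hn b hb hP hM η hη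
  have hw : Measurable v := hv.1
  -- notation
  set E₀ : ℝ≥0∞ := periodicGroundStateEnergy v (m + 2) L with hE₀
  set e0 : ℝ := E₀.toReal with he0
  set e1 : ℝ := (periodicGroundStateEnergy v (m + 1) L).toReal with he1
  set e3 : ℝ := (periodicGroundStateEnergy v (m + 3) L).toReal with he3
  set V₁ : ℝ := (∫⁻ x : Space, v ‖x‖).toReal with hV₁
  have hV₁0 : 0 ≤ V₁ := ENNReal.toReal_nonneg
  set pv : Space := latticeVec (2 * Real.pi / L) n with hpv
  set D : ℝ := ‖pv‖ ^ 2 + 2 * ((m : ℝ) + 2) * V₁ / L ^ 3 with hD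
  have he0_0 : 0 ≤ e0 := ENNReal.toReal_nonneg
  -- the a priori constant for `𝓔[a†aψ]`
  set cB : ℝ := ‖pv‖ ^ 2 + ((m : ℝ) + 1) * V₁ / L ^ 3 with hcB
  have hcB0 : 0 ≤ cB := by positivity
  set Kb : ℝ := ((m : ℝ) + 2) * (((m : ℝ) + 2) * (e0 + 1) + cB * ((m : ℝ) + 2)) with hKb
  -- the slacks: the two channels at `η`, and `δ₀` absorbing the polar error
  obtain ⟨δ₀, hδ₀, hδ₀1, hslack⟩ := KLS.exists_slack (Kb := Kb) hη
  obtain ⟨δP, hδP, HP⟩ := hP η hη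
  obtain ⟨δM, hδM, HM⟩ := hM η hη
  set δ : ℝ≥0∞ := min (min δP δM) (ENNReal.ofReal δ₀) with hδdef
  have hδpos : 0 < δ := lt_min (lt_min hδP hδM) (ENNReal.ofReal_pos.2 hδ₀)
  have hδleP : δ ≤ δP := (min_le_left _ _).trans (min_le_left _ _)
  have hδleM : δ ≤ δM := (min_le_left _ _).trans (min_le_right _ _)
  have hδle0 : δ ≤ ENNReal.ofReal δ₀ := min_le_right _ _
  have hδtop : δ ≠ ⊤ := ne_top_of_le_ne_top ENNReal.ofReal_ne_top hδle0
  refine ⟨δ, hδpos, fun Ψ hΨ => ?_⟩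
  -- ===== the per-state bound =====
  set δr : ℝ := δ.toReal with hδr
  have hδr0 : 0 ≤ δr := ENNReal.toReal_nonneg
  have hδrle : δr ≤ δ₀ := by
    have h := ENNReal.toReal_mono ENNReal.ofReal_ne_top hδle0
    rwa [ENNReal.toReal_ofReal hδ₀.le] at h
  have hδr1 : δr ≤ 1 := hδrle.trans hδ₀1
  have hslackδ := hslack δr hδr0 hδrle
  -- the state
  set ψ : Config (m + 2) → ℂ := Ψ.ψ with hψdef
  have hψc : IsCore L ψ := isCore_trialState Ψ
  have hψ1 : normSq L ψ = 1 := Ψ.norm_eq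
  have hψE : qform v L ψ ≤ E₀ + δ := hΨ
  have hEδtop : E₀ + δ ≠ ⊤ := ENNReal.add_ne_top.2 ⟨hE2, hδtop⟩
  have hψEtop : qform v L ψ ≠ ⊤ := ne_top_of_le_ne_top hEδtop hψE
  set qΨ : ℝ := (qform v L ψ).toReal with hqΨ
  have hqΨ0 : 0 ≤ qΨ := ENNReal.toReal_nonneg
  have hq : qΨ ≤ e0 + δr := by
    have h := ENNReal.toReal_mono hEδtop hψE
    rwa [ENNReal.toReal_add hE2 hδtop] at h
  -- the excitation `aψ`, the particle state `a†ψ`, and `a†aψ`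
  set aΨ : Config (m + 1) → ℂ := modeAn L (planeWaveMode L n) ψ with haΨ
  set cΨ : Config (m + 2 + 1) → ℂ := modeCr (planeWaveMode L n) ψ with hcΨ
  set NΨ : Config (m + 2) → ℂ := modeCr (planeWaveMode L n) aΨ with hNΨ
  have haΨc : IsCore L aΨ := isCore_modeAn hL n hψc
  have hcΨc : IsCore L cΨ := isCore_modeCr hL n hψc
  have hNΨc : IsCore L NΨ := isCore_modeCr hL n haΨc
  -- masses: `‖aψ‖² = n_k`, `‖a†ψ‖² = 1 + n_k`
  set νE : ℝ≥0∞ := cellOccupation (m + 2) L (planeWaveMode L n) ψ with hνE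
  have hnAE : normSq L aΨ = νE := normSq_modeAn hL n ψ
  have hnCE : normSq L cΨ = 1 + νE := by rw [hcΨ, normSq_modeCr hL n hψc, hψ1]
  have hνle : νE ≤ ((m + 2 : ℕ) : ℝ≥0∞) * normSq L ψ :=
    cellOccupation_le_mul_normSq hL n hψc.contDiff.continuous
  rw [hψ1, mul_one] at hνle
  have hνtop : νE ≠ ⊤ := ne_top_of_le_ne_top (ENNReal.natCast_ne_top _) hνle
  set nA : ℝ := νE.toReal with hnA
  have hnA0 : 0 ≤ nA := ENNReal.toReal_nonneg
  have hnAle : nA ≤ (m : ℝ) + 2 := by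
    have h := ENNReal.toReal_mono (ENNReal.natCast_ne_top _) hνle
    rw [ENNReal.toReal_natCast] at h
    push_cast at h
    exact h
  have hnAtop : normSq L aΨ ≠ ⊤ := by rw [hnAE]; exact hνtop
  have hnCtop : normSq L cΨ ≠ ⊤ := by
    rw [hnCE]; exact ENNReal.add_ne_top.2 ⟨ENNReal.one_ne_top, hνtop⟩
  have hnC0 : normSq L cΨ ≠ 0 := by
    rw [hnCE]; exact ne_of_gt (lt_of_lt_of_le zero_lt_one le_self_add)
  have hnAr : (normSq L aΨ).toReal = nA := by rw [hnAE]
  have hnCr : (normSq L cΨ).toReal = nA + 1 := by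
    rw [hnCE, ENNReal.toReal_add ENNReal.one_ne_top hνtop, ENNReal.toReal_one]; ring
  have hnA1 : 0 < nA + 1 := by linarith
  -- a priori energy bounds for `aψ`, `a†ψ`, `a†aψ`
  have haΨE := qform_modeAn_le hL hw n hψc
  have haΨEtop : qform v L aΨ ≠ ⊤ :=
    ne_top_of_le_ne_top (ENNReal.mul_ne_top (natCast_add_one_ne_top _) hψEtop) haΨE
  have hcΨE := qform_modeCr_le hL hw hint n hψc
  have hcΨEtop : qform v L cΨ ≠ ⊤ :=
    ne_top_of_le_ne_top (ENNReal.mul_ne_top (natCast_add_one_ne_top _) (ENNReal.add_ne_top.2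
      ⟨hψEtop, ENNReal.mul_ne_top ENNReal.ofReal_ne_top (by rw [hψ1]; exact ENNReal.one_ne_top)⟩)) hcΨE
  have hNΨE := qform_modeCr_le hL hw hint n haΨc
  have hNΨEtop : qform v L NΨ ≠ ⊤ :=
    ne_top_of_le_ne_top (ENNReal.mul_ne_top (natCast_add_one_ne_top _) (ENNReal.add_ne_top.2
      ⟨haΨEtop, ENNReal.mul_ne_top ENNReal.ofReal_ne_top hnAtop⟩)) hNΨE
  set qA : ℝ := (qform v L aΨ).toReal with hqA
  set qC : ℝ := (qform v L cΨ).toReal with hqC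
  set K : ℝ := (qform v L NΨ).toReal with hK
  have hqA0 : 0 ≤ qA := ENNReal.toReal_nonneg
  have hqAr : qA ≤ ((m : ℝ) + 2) * qΨ := by
    have h := ENNReal.toReal_mono (ENNReal.mul_ne_top (natCast_add_one_ne_top _) hψEtop) haΨE
    rw [ENNReal.toReal_mul, toReal_natCast_add_one] at h
    push_cast at h
    linarith
  have hKr : K ≤ ((m : ℝ) + 2) * (qA + cB * nA) := by
    have h := ENNReal.toReal_mono (ENNReal.mul_ne_top (natCast_add_one_ne_top _) (ENNReal.add_ne_top.2
      ⟨haΨEtop, ENNReal.mul_ne_top ENNReal.ofReal_ne_top hnAtop⟩)) hNΨE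
    rw [ENNReal.toReal_mul, toReal_natCast_add_one, ENNReal.toReal_add haΨEtop
      (ENNReal.mul_ne_top ENNReal.ofReal_ne_top hnAtop), ENNReal.toReal_mul,
      ENNReal.toReal_ofReal (by positivity), hnAr] at h
    push_cast at h
    have hc : ‖pv‖ ^ 2 + ((m : ℝ) + 1) * V₁ / L ^ 3 = cB := by rw [hcB]
    rw [hc] at h
    linarith
  have hKle : K ≤ Kb := by
    have h1 : qA ≤ ((m : ℝ) + 2) * (e0 + 1) := by
      have hq1 : qΨ ≤ e0 + 1 := by linarith
      exact hqAr.trans (mul_le_mul_of_nonneg_left hq1 (by positivity))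
    have h3 : cB * nA ≤ cB * ((m : ℝ) + 2) := mul_le_mul_of_nonneg_left hnAle hcB0
    calc K ≤ ((m : ℝ) + 2) * (qA + cB * nA) := hKr
      _ ≤ ((m : ℝ) + 2) * (((m : ℝ) + 2) * (e0 + 1) + cB * ((m : ℝ) + 2)) := by gcongr
      _ = Kb := by rw [hKb]
  -- the Wagner–Feynman form inequality and the polar cross-term bound
  set B : ℝ := formRe v L ψ NΨ with hB
  have hWF : qA + qC ≤ D + qΨ + 2 * B := by
    have h := wagnerFeynman_form_le hL hw hint hn hψc hψEtop
    rw [hψ1, ENNReal.toReal_one, mul_one] at h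
    exact h
  have hBabs : |B - e0 * nA| ≤ Real.sqrt δr * Real.sqrt K := by
    have hnear : (qform v L ψ).toReal ≤ E₀.toReal * (normSq L ψ).toReal + δr := by
      rw [hψ1, ENNReal.toReal_one, mul_one]; exact hq
    have h := abs_formRe_sub_le hL hw hψc hNΨc hψEtop hNΨEtop hE2 hδr0 hnear
    have hi : innerRe L ψ NΨ = nA := innerRe_numOp hL n hψc
    rwa [hi] at h
  -- ===== channel `+`: the normalised particle state `a†ψ/‖a†ψ‖` =====
  have hchanP : (nA + 1) ^ 2 ≤ b * ((1 + η) * (qC - e3 * (nA + 1)) + η * (nA + 1)) := by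
    set Φp : PeriodicTrialState (m + 2 + 1) L := hcΨc.toTrialState hnC0 hnCtop with hΦp
    have hΦpE : periodicEnergy v Φp = (normSq L cΨ)⁻¹ * qform v L cΨ :=
      hcΨc.periodicEnergy_toTrialState v hnC0 hnCtop
    have hΦpEtop : periodicEnergy v Φp ≠ ⊤ := by
      rw [hΦpE]; exact ENNReal.mul_ne_top (ENNReal.inv_ne_top.2 hnC0) hcΨEtop
    have hΦpEr : (periodicEnergy v Φp).toReal = qC / (nA + 1) := by
      rw [hΦpE, ENNReal.toReal_mul, ENNReal.toReal_inv, hnCr, inv_mul_eq_div]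
    have hΨnear : NearMinAt v δP Ψ := le_trans hΨ (add_le_add le_rfl hδleP)
    have hPΨ := HP Ψ hΨnear Φp hΦpEtop
    -- the transfer matrix element is `‖a†ψ‖ = √(nA + 1)`
    have hMp : Real.sqrt (((m + 2 : ℕ) : ℝ) + 1) * transferIntegralRe L n Ψ.ψ Φp.ψ = Real.sqrt (nA + 1) := by
      rw [sqrt_mul_transferIntegralRe]
      have hΦpψ : Φp.ψ = fun X => ((Real.sqrt (normSq L cΨ).toReal)⁻¹ : ℂ) * cΨ X :=
        hcΨc.toTrialState_ψ hnC0 hnCtop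
      rw [hΦpψ, hnCr, modeAn_const_mul]
      have hfun : (fun Y => conj (Ψ.ψ Y) * (((Real.sqrt (nA + 1))⁻¹ : ℂ) * modeAn L (planeWaveMode L n) cΨ Y)) =
          fun Y => ((Real.sqrt (nA + 1))⁻¹ : ℂ) * (conj (ψ Y) * modeAn L (planeWaveMode L n) cΨ Y) := by
        funext Y; rw [hψdef]; ring
      rw [hfun, integral_const_mul]
      have hadj : ∫ Y in cellN (m + 2) L, conj (ψ Y) * modeAn L (planeWaveMode L n) cΨ Y =
          ((nA + 1 : ℝ) : ℂ) := by
        rw [← integral_conj_modeCr_mul (continuous_planeWaveMode L n).measurable (norm_planeWaveMode_le L n)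
          hψc.contDiff.continuous hcΨc.contDiff.continuous hcΨc.symm]
        rw [integral_conj_mul_self_eq L hcΨc.contDiff.continuous, hnCr]
      rw [hadj]
      exact re_inv_sqrt_mul_self hnA1.le
    rw [hMp, Real.sq_sqrt hnA1.le, hΦpEr] at hPΨ
    -- multiply by `nA + 1 > 0`
    have h := mul_le_mul_of_nonneg_left hPΨ hnA1.le
    have heq : (nA + 1) * (b * ((1 + η) * (qC / (nA + 1) - e3) + η)) =
        b * ((1 + η) * (qC - e3 * (nA + 1)) + η * (nA + 1)) := by
      field_simp
    calc (nA + 1) ^ 2 = (nA + 1) * (nA + 1) := by ring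
      _ ≤ (nA + 1) * (b * ((1 + η) * (qC / (nA + 1) - e3) + η)) := h
      _ = _ := heq
  -- ===== channel `−`: the normalised excitation `aψ/‖aψ‖` =====
  have hchanM : nA ^ 2 ≤ b * ((1 + η) * (qA - e1 * nA) + η * nA) := by
    rcases eq_or_ne νE 0 with hν0 | hν0
    · have hnA00 : nA = 0 := by rw [hnA, hν0, ENNReal.toReal_zero]
      rw [hnA00]
      have : 0 ≤ b * ((1 + η) * qA) := by positivity
      nlinarith
    have hnA0' : normSq L aΨ ≠ 0 := by rwa [hnAE]
    set Φm : PeriodicTrialState (m + 1) L := haΨc.toTrialState hnA0' hnAtop with hΦm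
    have hΦmE : periodicEnergy v Φm = (normSq L aΨ)⁻¹ * qform v L aΨ :=
      haΨc.periodicEnergy_toTrialState v hnA0' hnAtop
    have hΦmEtop : periodicEnergy v Φm ≠ ⊤ := by
      rw [hΦmE]; exact ENNReal.mul_ne_top (ENNReal.inv_ne_top.2 hnA0') haΨEtop
    have hΦmEr : (periodicEnergy v Φm).toReal = qA / nA := by
      rw [hΦmE, ENNReal.toReal_mul, ENNReal.toReal_inv, hnAr, inv_mul_eq_div]
    have hΨnear : NearMinAt v δM Ψ := le_trans hΨ (add_le_add le_rfl hδleM)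
    have hMΨ := HM Ψ hΨnear Φm hΦmEtop
    -- the transfer matrix element is `‖aψ‖ = √nA`
    have hMm : Real.sqrt (((m + 1 : ℕ) : ℝ) + 1) * transferIntegralRe L n Φm.ψ Ψ.ψ = Real.sqrt nA := by
      rw [sqrt_mul_transferIntegralRe]
      have hΦmψ : Φm.ψ = fun X => ((Real.sqrt (normSq L aΨ).toReal)⁻¹ : ℂ) * aΨ X :=
        haΨc.toTrialState_ψ hnA0' hnAtop
      rw [hΦmψ, hnAr]
      have hfun : (fun Y => conj (((Real.sqrt nA)⁻¹ : ℂ) * aΨ Y) * modeAn L (planeWaveMode L n) Ψ.ψ Y) =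
          fun Y => ((Real.sqrt nA)⁻¹ : ℂ) * (conj (aΨ Y) * aΨ Y) := by
        funext Y
        rw [map_mul, ← Complex.ofReal_inv, Complex.conj_ofReal, haΨ, hψdef]
        ring
      rw [hfun, integral_const_mul, integral_conj_mul_self_eq L haΨc.contDiff.continuous, hnAr]
      exact re_inv_sqrt_mul_self hnA0
    rw [hMm, Real.sq_sqrt hnA0, hΦmEr] at hMΨ
    have h := mul_le_mul_of_nonneg_left hMΨ hnA0
    have hnAne : nA ≠ 0 := (ENNReal.toReal_pos hν0 hνtop).ne'
    have heq : nA * (b * ((1 + η) * (qA / nA - e1) + η)) = b * ((1 + η) * (qA - e1 * nA) + η * nA) := by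
      field_simp
    calc nA ^ 2 = nA * nA := by ring
      _ ≤ nA * (b * ((1 + η) * (qA / nA - e1) + η)) := h
      _ = _ := heq
  -- ===== the real-arithmetic core =====
  intro nk
  exact KLS.real_core hb hη rfl hchanP hchanM hWF hq hBabs hKle hslackδ

end KLS

/-- **Stub S4 of the line `two-sector-gd-transfer`**: the Kennedy–Lieb–Shastry moment inequality at a near-minimiser,
`KLSMomentFor v`, for every integrable admissible pair potential `v`. -/
theorem stub_klsNearMinimiser : KLSNearMinimiser :=
  fun v hv hint => KLS.klsMomentFor v hv hint

end Summit.AtomisticToContinuum.BoseEinsteinCondensation.Cruxes.PeriodicIRBound.TwoSectorGdTransfer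

end
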